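import Summits.AtomisticToContinuum.BoseEinsteinCondensation.Theses.BECPopovBerryRG

/-!
# Birth skeleton for crux `BlockOccupationLD` (stmt-AtomisticToContinuum-14491)

Route `BECPopovBerryRG` (sub-problem `BoseEinsteinCondensation`), crux decl
`Summit.AtomisticToContinuum.BoseEinsteinCondensation.Theses.BECPopovBerryRG.BlockOccupationLD`:
block-occupation deficits of near-minimisers of the periodic dilute Bose gas are VOLUME-ORDER
large deviations, at every block scale `ℓ = L/m ≥ ℓ₀` — the large-field input of
`PolarTransferOS` (a deficient block-slab is a large-field region of activity `e^{-cρℓ³}`).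

## The line: reference-scale domination × sub-block pigeonhole × dominated union bound

Volume order at ALL scales is a statement about (approximate) independence of distant regions,
not about a single block: a block of side `ℓ = k ℓ'` with deficit fraction `η` contains at least
`η k³ / 2` sub-blocks of side `ℓ'` with deficit fraction `≥ η / 2` (pigeonhole), and if the joint
deficit events of DISTINCT reference blocks are dominated by a Bernoulli field of parameter
`p = e^{-c'ρℓ'³}` (one scale window `ℓ' ∈ [ℓ₁, 2ℓ₁]` suffices), a union bound over the `2^{k³}`
sub-families gives `2^{k³} p^{ηk³/2} ≤ e^{-(c'η/4) ρ ℓ³}` as soon as the reference scale is deep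
in the large-deviation regime (`c' η ρ ℓ₁³ ≳ log 2`). This is exactly the form in which the
route consumes the crux (large-field activities multiplicative over separated pieces).

* `stub_referenceScaleDomination` (XL, the physics; hardest stub): Bernoulli domination of the
  block-deficit field of `δ`-near-minimisers at ONE reference scale window. Not the crux: the
  window is bounded (the crux needs every `ℓ ≥ ℓ₀` up to `ℓ = L`), and the product structure
  over families of blocks is additional. True for `v ≡ 0` (multinomial counts are negatively
  associated; Chernoff), and for near-minimisers because `δ` is chosen after `N`
  (finite-volume gap, targets `≥ e^{-c'N}`).
* `stub_subblockPigeonhole` (M/L, deterministic geometry of the grid refinement `m ↦ m k`,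
  sub-block index `finProdFinEquiv (z j, w j) : Fin (m k)`, side `ℓ / k`).
* `stub_dominatedUnionBound` (M, abstract measure theory / counting: product bounds for an
  injectively re-indexed sub-family + `n log 2 ≤ a t / 2` ⇒ tail `e^{-at/2}` for the event
  "at least `t` of the `n` events occur").
* `BlockOccupationLD_of`: the kernel-checked composition (choice of `c = c'η/4`, `ℓ₀ = ℓ₁`,
  `k = ⌊ℓ/ℓ₁⌋`, window and depth arithmetic, set inclusion, exponent identity).

Disproof used: none exists yet for this crux (no `Cruxes/BlockOccupationLD/Disproof.lean`, no
landed `Negative/` lemma, nothing on block occupations in `ledger negatives`).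
-/

namespace Summit.AtomisticToContinuum.BoseEinsteinCondensation.Cruxes.BlockOccupationLD.Birth

open MeasureTheory Filter
open scoped ENNReal NNReal BigOperators
open Literature.MathematicalPhysics.QuantumManyBody.BoseGas

/-- **Stub 1 (reference-scale Bernoulli domination of block deficits; XL, the hardest stub).**
For every repulsive finite-range `v` there is `ρ₀ > 0` such that for `0 < ρ < ρ₀` and every
deficit fraction `η ∈ (0,1)` there are a rate `c' > 0` and a reference scale `ℓ₁ > 0`, deep in the
large-deviation regime (`8 log 2 ≤ c' η ρ ℓ₁³`), with: for all large `N` there is `δ > 0` such that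
for every `δ`-near-minimiser `Ψ` on the torus of side `L = (N/ρ)^{1/3}`, every block number `M`
whose block side `ℓ' = L/M` lies in the window `[ℓ₁, 2ℓ₁]`, and every finite family `T` of
DISTINCT grid blocks, the `|Ψ|²`-mass (on the fundamental cell) of the joint event "every block
of `T` holds at most `(1-η)ρℓ'³` particles" is at most `exp(-c'ρℓ'³)^{|T|}`.
Informally: at one mesoscopic scale the block-deficit indicator field of a near-ground state is
stochastically dominated by an i.i.d. Bernoulli(`e^{-c'ρℓ'³}`) field. (`v ≡ 0`: multinomial block
counts are negatively associated, so the product of binomial Chernoff tails bounds the joint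
event; near-minimisers: `δ` after `N` and the finite-volume gap.) -/
theorem stub_referenceScaleDomination :
    ∀ v : ℝ → ℝ≥0∞, IsRepulsiveFiniteRange v → ∃ ρ₀ : ℝ, 0 < ρ₀ ∧ ∀ ρ : ℝ, 0 < ρ → ρ < ρ₀ →
      ∀ η : ℝ, 0 < η → η < 1 → ∃ c' ℓ₁ : ℝ, 0 < c' ∧ 0 < ℓ₁ ∧
        8 * Real.log 2 ≤ c' * η * ρ * ℓ₁ ^ 3 ∧
        ∀ᶠ N : ℕ in atTop, ∃ δ : ℝ≥0∞, 0 < δ ∧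
          ∀ Ψ : PeriodicTrialState N (sideLength ρ N),
            periodicEnergy v Ψ ≤ periodicGroundStateEnergy v N (sideLength ρ N) + δ →
            ∀ M : ℕ, 0 < M → ∀ ℓ' : ℝ, ℓ' = sideLength ρ N / M → ℓ₁ ≤ ℓ' → ℓ' ≤ 2 * ℓ₁ →
              ∀ T : Finset (Fin 3 → Fin M),
                ∫⁻ X in {X : Config N | X ∈ cellN N (sideLength ρ N) ∧ ∀ z' ∈ T,
                    (∑ i, ({x : Space | ∀ j, x j ∈ Set.Ico (((z' j : ℕ) : ℝ) * ℓ')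
                      ((((z' j : ℕ) : ℝ) + 1) * ℓ')}).indicator (fun _ => (1 : ℝ)) (X i)) ≤
                      (1 - η) * ρ * ℓ' ^ 3},
                  (‖Ψ.ψ X‖₊ : ℝ≥0∞) ^ 2 ≤
                ENNReal.ofReal (Real.exp (-(c' * ρ * ℓ' ^ 3))) ^ T.card := by
  sorry

/-- **Stub 2 (sub-block pigeonhole; M/L, deterministic).** Refine the grid of block number `m`
(block side `ℓ`) by a factor `k`: the sub-blocks of block `z` are the grid-`(m k)` blocks with
index `j ↦ finProdFinEquiv (z j, w j) = w j + k · z j`, `w : Fin 3 → Fin k`, of side `ℓ / k`; they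
partition block `z`, so the particle count of `z` is the sum of the `k³` sub-block counts. If block
`z` holds at most `(1-η)ρℓ³` particles then at least `η k³ / 2` of its sub-blocks hold at most
`(1 - η/2) ρ (ℓ/k)³` particles (else more than `(1 - η/2)·k³·(1-η/2)⁻¹(1-η)`… sub-blocks exceed
their threshold and the total exceeds `(1-η)ρℓ³`). Pure finite-sum/partition bookkeeping over
`EuclideanSpace ℝ (Fin 3)` with half-open intervals; no measure theory, no physics. -/
theorem stub_subblockPigeonhole :
    ∀ (N m k : ℕ) (ρ ℓ η : ℝ), 0 < m → 0 < k → 0 < ρ → 0 < ℓ → 0 < η → η < 1 →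
      ∀ (X : Config N) (z : Fin 3 → Fin m),
        (∑ i, ({x : Space | ∀ j, x j ∈ Set.Ico (((z j : ℕ) : ℝ) * ℓ)
            ((((z j : ℕ) : ℝ) + 1) * ℓ)}).indicator (fun _ => (1 : ℝ)) (X i)) ≤
            (1 - η) * ρ * ℓ ^ 3 →
        η * (k : ℝ) ^ 3 / 2 ≤
          (({w : Fin 3 → Fin k |
              (∑ i, ({x : Space | ∀ j, x j ∈ Set.Ico
                  ((((finProdFinEquiv (z j, w j) : Fin (m * k)) : ℕ) : ℝ) * (ℓ / k))
                  (((((finProdFinEquiv (z j, w j) : Fin (m * k)) : ℕ) : ℝ) + 1) * (ℓ / k))}).indicator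
                (fun _ => (1 : ℝ)) (X i)) ≤ (1 - η / 2) * ρ * (ℓ / k) ^ 3}.ncard : ℕ) : ℝ) := by
  sorry

/-- **Stub 3 (dominated union bound; M, abstract).** Let `f` be a density on a measure space,
`S₀` a base event, `A : κ → Set Ω` a family of events whose joint occurrences on `S₀` are
dominated by a Bernoulli product, `∫_{S₀ ∩ ⋂_{j∈T} A j} f ≤ (e^{-a})^{|T|}` for every finite `T`,
and `b : ι → κ` an injective re-indexing of `n = |ι|` of them. If `n log 2 ≤ a t / 2` then the
`f`-mass of "`x ∈ S₀` and at least `t` of the events `A (b i)` occur" is at most `e^{-at/2}`: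
cover by the `≤ 2ⁿ` sub-families of size `≥ t`, each of mass `≤ e^{-at}`. (Counting via
`Set.ncard`, so no decidability instances enter the statement.) -/
theorem stub_dominatedUnionBound :
    ∀ (Ω : Type) [MeasurableSpace Ω] (μ : Measure Ω) (f : Ω → ℝ≥0∞) (S₀ : Set Ω)
      (ι κ : Type) [Fintype ι] (b : ι → κ), Function.Injective b →
      ∀ (A : κ → Set Ω) (a t : ℝ), 0 ≤ a → 0 < t →
        Real.log 2 * (Fintype.card ι : ℝ) ≤ a * t / 2 →
        (∀ T : Finset κ, ∫⁻ x in {x | x ∈ S₀ ∧ ∀ j ∈ T, x ∈ A j}, f x ∂μ ≤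
            ENNReal.ofReal (Real.exp (-a)) ^ T.card) →
        ∫⁻ x in {x | x ∈ S₀ ∧ t ≤ (({i : ι | x ∈ A (b i)}.ncard : ℕ) : ℝ)}, f x ∂μ ≤
          ENNReal.ofReal (Real.exp (-(a * t / 2))) := by
  sorry

/-- **Composition (kernel-checked, no `sorry` of its own).** The three stubs, used by name, give the
crux `BECPopovBerryRG.BlockOccupationLD` BY NAME: given `v`, take `ρ₀` from Stub 1; given `ρ, η`, apply
Stub 1 with deficit fraction `η/2` to get `c', ℓ₁`; answer the crux with `c := c'η/4`, `ℓ₀ := ℓ₁`.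
For a block of side `ℓ = L/m ≥ ℓ₁` put `k := ⌊ℓ/ℓ₁⌋ ≥ 1`, so the sub-block side `ℓ/k = L/(mk)`
lies in the window `[ℓ₁, 2ℓ₁]`; Stub 2 puts the deficit event inside "at least `ηk³/2` of the `k³`
sub-blocks are `η/2`-deficient", Stub 3 (fed by Stub 1 on the grid `m k`, re-indexing
`w ↦ (j ↦ finProdFinEquiv (z j, w j))`, depth `log 2 · k³ ≤ c'ρ(ℓ/k)³ · (ηk³/2)/2` from
`8 log 2 ≤ c'(η/2)ρℓ₁³`) bounds its mass by `exp(-(c'ρ(ℓ/k)³ · ηk³/2)/2) = exp(-(c'η/4)ρℓ³)`. -/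
theorem BlockOccupationLD_of :
    Summit.AtomisticToContinuum.BoseEinsteinCondensation.Theses.BECPopovBerryRG.BlockOccupationLD := by
  -- the three registered stubs, used BY NAME (the composition has no hypotheses of its own)
  have h1 := @stub_referenceScaleDomination
  have h2 := @stub_subblockPigeonhole
  have h3 := @stub_dominatedUnionBound
  intro v hv
  obtain ⟨ρ₀, hρ₀, H⟩ := h1 v hv
  refine ⟨ρ₀, hρ₀, fun ρ hρ hρlt η hη hη1 => ?_⟩
  obtain ⟨c', ℓ₁, hc', hℓ₁, hdepth, hev⟩ :=
    H ρ hρ hρlt (η / 2) (by linarith) (by linarith)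
  refine ⟨c' * η / 4, ℓ₁, by positivity, hℓ₁, ?_⟩
  refine hev.mono fun N hN => ?_
  obtain ⟨δ, hδ, hΨ⟩ := hN
  refine ⟨δ, hδ, fun Ψ hE m hm => ?_⟩
  dsimp only
  generalize hℓdef : sideLength ρ N / (m : ℝ) = ℓ
  intro hℓ z
  have hℓpos : 0 < ℓ := lt_of_lt_of_le hℓ₁ hℓ
  -- the refinement factor `k = ⌊ℓ / ℓ₁⌋ ≥ 1`, so that `ℓ / k ∈ [ℓ₁, 2ℓ₁]`
  obtain ⟨k, hk0, hkle, hklt⟩ : ∃ k : ℕ, 0 < k ∧ (k : ℝ) ≤ ℓ / ℓ₁ ∧ ℓ / ℓ₁ < k + 1 :=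
    ⟨⌊ℓ / ℓ₁⌋₊, Nat.floor_pos.mpr ((one_le_div hℓ₁).mpr hℓ), Nat.floor_le (by positivity),
      Nat.lt_floor_add_one _⟩
  have hkpos : (0 : ℝ) < k := by exact_mod_cast hk0
  have hk1 : (1 : ℝ) ≤ k := by exact_mod_cast hk0
  have hwin1 : ℓ₁ ≤ ℓ / k := by
    rw [le_div_iff₀ hkpos]
    have := (le_div_iff₀ hℓ₁).mp hkle
    linarith
  have hwin2 : ℓ / k ≤ 2 * ℓ₁ := by
    rw [div_le_iff₀ hkpos]
    have h' : ℓ < (k + 1) * ℓ₁ := (div_lt_iff₀ hℓ₁).mp hklt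
    nlinarith [mul_le_mul_of_nonneg_right hk1 hℓ₁.le]
  have hside : ℓ / k = sideLength ρ N / ((m * k : ℕ) : ℝ) := by
    rw [← hℓdef, Nat.cast_mul, div_div]
  -- Stub 1 on the refined grid of block number `m * k`, block side `ℓ / k`
  have hprod := hΨ Ψ hE (m * k) (Nat.mul_pos hm hk0) (ℓ / k) hside hwin1 hwin2
  -- the injective re-indexing of the sub-blocks of `z`
  have hb : Function.Injective
      (fun w : Fin 3 → Fin k => fun j : Fin 3 => (finProdFinEquiv (z j, w j) : Fin (m * k))) := by
    intro w w' h
    funext j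
    exact (Prod.ext_iff.mp (finProdFinEquiv.injective (congr_fun h j))).2
  -- depth of the reference scale: `log 2 · k³ ≤ (c' ρ (ℓ/k)³) · (η k³ / 2) / 2`
  have hcard : (Fintype.card (Fin 3 → Fin k) : ℝ) = (k : ℝ) ^ 3 := by
    rw [Fintype.card_fun, Fintype.card_fin, Fintype.card_fin]
    push_cast
    ring
  have hdep : Real.log 2 * (Fintype.card (Fin 3 → Fin k) : ℝ) ≤
      c' * ρ * (ℓ / k) ^ 3 * (η * (k : ℝ) ^ 3 / 2) / 2 := by
    rw [hcard]
    have hQ : 8 * Real.log 2 ≤ c' * (η / 2) * ρ * (ℓ / k) ^ 3 :=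
      hdepth.trans (by gcongr)
    have hlog : 0 < Real.log 2 := Real.log_pos one_lt_two
    calc Real.log 2 * (k : ℝ) ^ 3
        ≤ (c' * (η / 2) * ρ * (ℓ / k) ^ 3 / 2) * (k : ℝ) ^ 3 := by
          gcongr
          linarith
      _ = c' * ρ * (ℓ / k) ^ 3 * (η * (k : ℝ) ^ 3 / 2) / 2 := by ring
  have ht : 0 < η * (k : ℝ) ^ 3 / 2 := div_pos (mul_pos hη (pow_pos hkpos 3)) two_pos
  have ha : 0 ≤ c' * ρ * (ℓ / k) ^ 3 := by positivity
  -- Stub 3: the dominated union bound over the `k³` sub-blocks of `z`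
  have hU := h3 (Config N) volume (fun X => (‖Ψ.ψ X‖₊ : ℝ≥0∞) ^ 2) (cellN N (sideLength ρ N))
    (Fin 3 → Fin k) (Fin 3 → Fin (m * k)) _ hb
    (fun z' : Fin 3 → Fin (m * k) => {X : Config N |
      (∑ i, ({x : Space | ∀ j, x j ∈ Set.Ico (((z' j : ℕ) : ℝ) * (ℓ / k))
        ((((z' j : ℕ) : ℝ) + 1) * (ℓ / k))}).indicator (fun _ => (1 : ℝ)) (X i)) ≤
        (1 - η / 2) * ρ * (ℓ / k) ^ 3})
    (c' * ρ * (ℓ / k) ^ 3) (η * (k : ℝ) ^ 3 / 2) ha ht hdep hprod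
  -- assemble: Stub 2 gives the inclusion of events, Stub 3 the bound, then the exponent identity
  refine le_trans ?_ (hU.trans (le_of_eq ?_))
  · refine lintegral_mono_set ?_
    intro X hX
    exact ⟨hX.1, h2 N m k ρ ℓ η hm hk0 hρ hℓpos hη hη1 X z hX.2⟩
  · have hk' : (k : ℝ) ≠ 0 := hkpos.ne'
    congr 2
    field_simp
    ring

end Summit.AtomisticToContinuum.BoseEinsteinCondensation.Cruxes.BlockOccupationLD.Birth
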